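import Mathlib
import Summits.CriticalPhenomena.Ising3DConformalLimit.Theorems.HyperoctahedralRPNullConeLocalRigidityFibre

/-!
# Null-cone local rigidity — divisibility by the null quadric

Helper file for item `stmt-CriticalPhenomena-4275`
(`Summit.CriticalPhenomena.Ising3DConformalLimit.Theses.HyperoctahedralRP.NullConeLocalRigidity`).

* `quad_dvd_of_aeval_null_eq_zero`: a real polynomial `P(y₀, y₁, y₂)` vanishing at the complex
  null vectors `(i√(v₀² + 2v₁²), v₀, v₁)` for all real `(v₀, v₁) ≠ 0` is divisible by
  `y₀² + y₁² + 2y₂²`.  Proof: divide by the monic quadratic `Y² + (y₁² + 2y₂²)` in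
  `ℝ[y₁, y₂][Y]` (`finSuccEquiv`, `modByMonic`); the remainder `r₁ Y + r₀` evaluated at a null
  vector gives `r₁(v) i√c + r₀(v) = 0` with `r₀(v), r₁(v)` real, so `r₀ = r₁ = 0` on
  `ℝ² ∖ {0}`, hence `rⱼ · y₁ = 0` on `ℝ²` and `rⱼ = 0` (`MvPolynomial.funext`).
* `sumSq_dvd_of_rotated_dvd`: back to the original coordinates,
  `y₀² + y₁² + 2y₂² ∣ 2^m Q((y₀+y₁)/2, (y₀-y₁)/2, y₂)` gives `x·x ∣ Q`.
* `eq_mul_homogeneousComponent`: the cofactor of a homogeneous polynomial may be taken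
  homogeneous.
-/

noncomputable section

open MvPolynomial

namespace Summit.CriticalPhenomena.Ising3DConformalLimit.Theorems.NullConeLocalRigidity

/-- `finSuccEquiv` of a polynomial in the last `n` variables is a constant polynomial. -/
theorem finSuccEquiv_rename_succ {n : ℕ} (s : MvPolynomial (Fin n) ℝ) :
    finSuccEquiv ℝ n (rename Fin.succ s) = Polynomial.C s := by
  induction s using MvPolynomial.induction_on with
  | C a =>
    rw [rename_C, finSuccEquiv_apply]
    simp
  | add p q hp hq => rw [map_add, map_add, hp, hq, Polynomial.C_add]
  | mul_X p j hp => rw [map_mul, map_mul, hp, rename_X, finSuccEquiv_X_succ, Polynomial.C_mul]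

/-- **Divisibility by the null quadric.** A real polynomial in `y₀, y₁, y₂` vanishing at the
complex null vectors `(i√(v₀²+2v₁²), v₀, v₁)`, `(v₀, v₁) ∈ ℝ² ∖ {0}`, is divisible by
`y₀² + y₁² + 2 y₂²`. -/
theorem quad_dvd_of_aeval_null_eq_zero (P : MvPolynomial (Fin 3) ℝ)
    (h : ∀ v : Fin 2 → ℝ, v ≠ 0 → MvPolynomial.aeval
      (Fin.cons (Complex.I * Real.sqrt (v 0 ^ 2 + 2 * v 1 ^ 2)) (fun j => (v j : ℂ)) :
        Fin 3 → ℂ) P = 0) :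
    ((X 0 : MvPolynomial (Fin 3) ℝ) ^ 2 + X 1 ^ 2 + 2 * X 2 ^ 2) ∣ P := by
  set w : MvPolynomial (Fin 2) ℝ := X 0 ^ 2 + 2 * X 1 ^ 2 with hw
  set D : Polynomial (MvPolynomial (Fin 2) ℝ) := Polynomial.X ^ 2 + Polynomial.C w with hD
  have hDm : D.Monic := Polynomial.monic_X_pow_add_C w two_ne_zero
  have hX1 : finSuccEquiv ℝ 2 (X 1) = Polynomial.C (X 0) := finSuccEquiv_X_succ (j := 0)
  have hX2 : finSuccEquiv ℝ 2 (X 2) = Polynomial.C (X 1) := finSuccEquiv_X_succ (j := 1)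
  have hDeq : finSuccEquiv ℝ 2 ((X 0 : MvPolynomial (Fin 3) ℝ) ^ 2 + X 1 ^ 2 + 2 * X 2 ^ 2)
      = D := by
    rw [map_add, map_add, map_pow, map_pow, map_mul, map_pow, finSuccEquiv_X_zero, hX1, hX2,
      map_ofNat, hD, hw]
    simp only [map_add, map_pow, map_mul, map_ofNat]
    ring
  set Ph := finSuccEquiv ℝ 2 P with hPh
  have hdiv := Polynomial.modByMonic_add_div Ph D
  set R := Ph %ₘ D with hR
  have hRdeg : R.natDegree ≤ 1 := by
    have h1 : R.natDegree < D.natDegree :=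
      Polynomial.natDegree_modByMonic_lt Ph hDm (by
        intro h1
        have := congrArg Polynomial.natDegree h1
        rw [hD, Polynomial.natDegree_X_pow_add_C, Polynomial.natDegree_one] at this
        exact absurd this two_ne_zero)
    rw [hD, Polynomial.natDegree_X_pow_add_C] at h1
    omega
  have hReq : R = Polynomial.C (R.coeff 1) * Polynomial.X + Polynomial.C (R.coeff 0) :=
    Polynomial.eq_X_add_C_of_natDegree_le_one hRdeg
  set r1 := R.coeff 1 with hr1
  set r0 := R.coeff 0 with hr0
  -- pull the division back to three variables
  have hsymmC : ∀ s : MvPolynomial (Fin 2) ℝ,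
      (finSuccEquiv ℝ 2).symm (Polynomial.C s) = rename Fin.succ s := by
    intro s
    apply (finSuccEquiv ℝ 2).injective
    rw [AlgEquiv.apply_symm_apply, finSuccEquiv_rename_succ]
  set M := (finSuccEquiv ℝ 2).symm (Ph /ₘ D) with hM
  have hP : P = ((X 0 : MvPolynomial (Fin 3) ℝ) ^ 2 + X 1 ^ 2 + 2 * X 2 ^ 2) * M
      + rename Fin.succ r1 * X 0 + rename Fin.succ r0 := by
    apply (finSuccEquiv ℝ 2).injective
    rw [map_add, map_add, map_mul, map_mul, hDeq, hM, AlgEquiv.apply_symm_apply,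
      finSuccEquiv_rename_succ, finSuccEquiv_rename_succ, finSuccEquiv_X_zero, ← hPh]
    conv_lhs => rw [← hdiv, hReq]
    ring
  -- the remainder vanishes on `ℝ² ∖ {0}`
  have hr : ∀ v : Fin 2 → ℝ, v ≠ 0 → eval v r0 = 0 ∧ eval v r1 = 0 := by
    intro v hv
    set c := v 0 ^ 2 + 2 * v 1 ^ 2 with hc
    have hc0 : 0 < c := by
      rcases Function.ne_iff.1 hv with ⟨j, hj⟩
      fin_cases j
      · have : v 0 ≠ 0 := hj
        positivity
      · have : v 1 ≠ 0 := hj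
        positivity
    have hsq : 0 < Real.sqrt c := Real.sqrt_pos.2 hc0
    have h0 := h v hv
    set z : Fin 3 → ℂ := Fin.cons (Complex.I * Real.sqrt c) (fun j => (v j : ℂ)) with hz
    have hzq : MvPolynomial.aeval z ((X 0 : MvPolynomial (Fin 3) ℝ) ^ 2 + X 1 ^ 2 + 2 * X 2 ^ 2)
        = 0 := by
      rw [hz, aeval_cons_quad, mul_pow, Complex.I_sq, ← Complex.ofReal_pow, Real.sq_sqrt hc0.le,
        hc]
      push_cast
      ring
    have hren : ∀ s : MvPolynomial (Fin 2) ℝ, MvPolynomial.aeval z (rename Fin.succ s)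
        = ((MvPolynomial.aeval v s : ℝ) : ℂ) := by
      intro s
      rw [aeval_rename]
      have : z ∘ Fin.succ = algebraMap ℝ ℂ ∘ v := by
        funext j
        simp [hz]
      rw [this, aeval_algebraMap_apply]
      rfl
    have hz0 : z 0 = Complex.I * Real.sqrt c := rfl
    rw [hP, map_add, map_add, map_mul, map_mul, hzq, zero_mul, zero_add, hren, hren,
      MvPolynomial.aeval_X, hz0] at h0
    have hre := congrArg Complex.re h0
    have him := congrArg Complex.im h0
    simp only [Complex.add_re, Complex.mul_re, Complex.ofReal_re, Complex.ofReal_im,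
      Complex.I_re, Complex.I_im, Complex.mul_im, Complex.zero_re, Complex.add_im,
      Complex.zero_im] at hre him
    ring_nf at hre him
    refine ⟨?_, ?_⟩
    · simpa [MvPolynomial.coe_aeval_eq_eval] using hre
    · have : (MvPolynomial.aeval v) r1 = 0 := by
        rcases mul_eq_zero.1 him with h1 | h1
        · exact h1
        · exact absurd h1 hsq.ne'
      simpa [MvPolynomial.coe_aeval_eq_eval] using this
  -- hence the remainder is zero
  have hzero : ∀ r : MvPolynomial (Fin 2) ℝ, (∀ v : Fin 2 → ℝ, v ≠ 0 → eval v r = 0) → r = 0 := by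
    intro r hrv
    have h1 : r * X 0 = 0 := by
      apply MvPolynomial.funext
      intro x
      rw [map_mul, eval_X, map_zero]
      by_cases hx : x = 0
      · simp [hx]
      · rw [hrv x hx, zero_mul]
    exact (mul_eq_zero.1 h1).resolve_right (X_ne_zero 0)
  have hr0z : r0 = 0 := hzero r0 fun v hv => (hr v hv).1
  have hr1z : r1 = 0 := hzero r1 fun v hv => (hr v hv).2
  refine ⟨M, ?_⟩
  rw [hP, hr0z, hr1z, map_zero]
  ring

/-- **Back to the original coordinates.** With `L = ((y₀+y₁)/2, (y₀-y₁)/2, y₂)`: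
if `y₀² + y₁² + 2y₂² ∣ 2^m · Q ∘ L` then `x₀² + x₁² + x₂² ∣ Q`. -/
theorem sumSq_dvd_of_rotated_dvd {m : ℕ} (Q : MvPolynomial (Fin 3) ℝ)
    (h : ((X 0 : MvPolynomial (Fin 3) ℝ) ^ 2 + X 1 ^ 2 + 2 * X 2 ^ 2) ∣
      MvPolynomial.C ((2 : ℝ) ^ m) * MvPolynomial.aeval
        ![MvPolynomial.C (1 / 2 : ℝ) * (X 0 + X 1), MvPolynomial.C (1 / 2 : ℝ) * (X 0 - X 1),
          (X 2 : MvPolynomial (Fin 3) ℝ)] Q) :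
    ((X 0 : MvPolynomial (Fin 3) ℝ) ^ 2 + X 1 ^ 2 + X 2 ^ 2) ∣ Q := by
  obtain ⟨M, hM⟩ := h
  set Linv : Fin 3 → MvPolynomial (Fin 3) ℝ := ![X 0 + X 1, X 0 - X 1, X 2] with hLinv
  have hinv : ∀ P : MvPolynomial (Fin 3) ℝ, MvPolynomial.aeval Linv (MvPolynomial.aeval
      ![MvPolynomial.C (1 / 2 : ℝ) * (X 0 + X 1), MvPolynomial.C (1 / 2 : ℝ) * (X 0 - X 1),
        (X 2 : MvPolynomial (Fin 3) ℝ)] P) = P := by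
    intro P
    rw [MvPolynomial.comp_aeval_apply]
    have : (fun i => MvPolynomial.aeval Linv
        (![MvPolynomial.C (1 / 2 : ℝ) * (X 0 + X 1), MvPolynomial.C (1 / 2 : ℝ) * (X 0 - X 1),
          (X 2 : MvPolynomial (Fin 3) ℝ)] i)) = X := by
      funext i
      fin_cases i
      · simp [hLinv]
        rw [← two_mul, ← map_ofNat (MvPolynomial.C : ℝ →+* MvPolynomial (Fin 3) ℝ) 2,
          ← mul_assoc, ← map_mul, inv_mul_cancel₀ (two_ne_zero : (2 : ℝ) ≠ 0), map_one, one_mul]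
      · simp [hLinv]
        rw [← two_mul, ← map_ofNat (MvPolynomial.C : ℝ →+* MvPolynomial (Fin 3) ℝ) 2,
          ← mul_assoc, ← map_mul, inv_mul_cancel₀ (two_ne_zero : (2 : ℝ) ≠ 0), map_one, one_mul]
      · simp [hLinv]
    rw [this, MvPolynomial.aeval_X_left_apply]
  have h2 := congrArg (MvPolynomial.aeval Linv) hM
  rw [map_mul, map_mul, MvPolynomial.aeval_C, hinv, MvPolynomial.algebraMap_eq] at h2
  have hq : MvPolynomial.aeval Linv ((X 0 : MvPolynomial (Fin 3) ℝ) ^ 2 + X 1 ^ 2 + 2 * X 2 ^ 2)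
      = 2 * ((X 0 : MvPolynomial (Fin 3) ℝ) ^ 2 + X 1 ^ 2 + X 2 ^ 2) := by
    simp only [map_add, map_mul, map_pow, map_ofNat, MvPolynomial.aeval_X, hLinv,
      Matrix.cons_val_zero, Matrix.cons_val_one, Matrix.cons_val_two, Matrix.head_cons,
      Matrix.tail_cons]
    ring
  rw [hq] at h2
  refine ⟨MvPolynomial.C (((2 : ℝ) ^ m)⁻¹) * (2 * MvPolynomial.aeval Linv M), ?_⟩
  have h3 : Q = MvPolynomial.C (((2 : ℝ) ^ m)⁻¹) * (MvPolynomial.C ((2 : ℝ) ^ m) * Q) := by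
    rw [← mul_assoc, ← map_mul, inv_mul_cancel₀ (pow_ne_zero _ two_ne_zero), map_one, one_mul]
  rw [h3, h2]
  ring

/-- **Homogeneous cofactor.** If `Q = p · M` with `p` homogeneous of degree `k` and `Q`
homogeneous of degree `k + n`, then `Q = p · M_n` with `M_n` the degree-`n` component of `M`. -/
theorem eq_mul_homogeneousComponent {σ : Type*} {p M Q : MvPolynomial σ ℝ} {k n : ℕ}
    (hp : p.IsHomogeneous k) (hQ : Q.IsHomogeneous (k + n)) (h : Q = p * M) :
    Q = p * homogeneousComponent n M := by
  have h1 : Q = homogeneousComponent (k + n) (p * M) := by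
    rw [← h, homogeneousComponent_eq_self hQ]
  rw [h1]
  conv_lhs => rw [← sum_homogeneousComponent (φ := M), Finset.mul_sum, map_sum]
  have h2 : ∀ i, homogeneousComponent (k + n) (p * homogeneousComponent i M)
      = if n = i then p * homogeneousComponent n M else 0 := by
    intro i
    rw [homogeneousComponent_of_mem (hp.mul (homogeneousComponent_isHomogeneous i M))]
    by_cases hi : n = i
    · subst hi; simp
    · rw [if_neg (by omega), if_neg hi]
  simp_rw [h2]
  rw [Finset.sum_ite_eq]
  split_ifs with hn
  · rfl
  · rw [homogeneousComponent_eq_zero, mul_zero]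
    simpa [Finset.mem_range, Nat.lt_succ_iff] using hn

end Summit.CriticalPhenomena.Ising3DConformalLimit.Theorems.NullConeLocalRigidity

end
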